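import Summits.SmoothPoincare4.SmoothPoincare4.Theorems.ConvexBisectionAcyclicBisectionExistsBeltMonodromyReturn
import Summits.SmoothPoincare4.SmoothPoincare4.Theorems.ConvexBisectionAcyclicBisectionExistsBeltMonodromyBelt
import HarnessLib

/-!
# N1-mono ▸ piece (d): THE ASSEMBLY CONTRACT of the deep-belt monodromy model
# `helper_N1_beltMonodromy_of_pieces (HΛ) (Hn) : <H4Interface.N1MonoStatement VERBATIM>`
(wave 8, brick of stub `stub_M2geo` = node N1 ▸ `piece_d` = `helper_N1_beltMonodromy`, line `modp-braid-orbits`,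
crux `ConvexBisection.AcyclicBisectionExists`, item stmt-SmoothPoincare4-10508; worker J3, lead c5; registered
sub-goal `helper_chartPoint_offCores`)

Piece (d) of `node_N1_move` (H4, `work/stubs/H4H7_interface.lean` FINAL v5; consumed verbatim by H7's contract through
J4's bridge `piece_e_cross`) is the TWO-SIDED FIBRED BELT CHART `Λ` with its RETURN MAP `G`.  It is assembled here from
TWO closed hypothesis texts (`work/stubs/J3_assumed.lean`, namespace `J3Interface`, for the texts with comments):
* `HΛ` = `FlowChartStatement` — THE GLUED CHART WITH RAW CLAUSES ((d7) assembled on J1's flat flow package): in the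
  telescope of `N1MonoStatement` VERBATIM, for every prescribed bound `η₂ > 0` a half-width `0 < η ≤ min η₁ η₂`, the glued
  chart `Λ` (smooth, immersive, injective on the fundamental box, `1`-periodic, FIBRED, BELOW/SIDES plain seam — six
  clauses VERBATIM from `N1MonoStatement`) and a RAW coordinate map `G₁`, smooth on the open strip `ℝ × (−1,1)` with values
  in the strip, through which `Λ` is plain seam ABOVE (`η/2 ≤ σ < η`; no equivariance, no normalisation), the RAW IMAGE
  clause (seam point over the chart annulus of the level or, at the level `0`, a belt-CIRCLE point) and the RAW COVER
  clauses (every seam point over the inner half annulus `φ_σ (ℝ × [−1/2, 1/2])` and every belt-circle point lies in the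
  slice of `Λ`) — the flow-region bookkeeping of the producer of `Λ`;
* `Hn` = `IntegerStatement` — THE INTEGER ((d9), uniqueness form): for ANY such `(η, Λ, G₁)` the raw displacement of
  `G₁` between the two side strips is `if s then 1 else −1` (Picard–Lefschetz; J2's linear model + J2-REPORT §3).
Proof: the angle gap of H4-1′ (`exists_angle_gap`) is prescribed as `η₂`; chart points off the belt level are then off
the cores (`helper_chartPoint_offCores`); the point-set seam family `p ↦ D.jA (φ p)` is `1`-periodic and injective on
the fundamental domain at the level `η/2`, so J3's `helper_beltReturnMap` (…BeltMonodromyReturn) normalises `G₁` into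
the return map `G`; `Hn` and the side identities of `G` pin `n₀ = if s then 1 else −1`; ABOVE follows; IMAGE from the
raw image clause (`jA_ne_jB_beltCirclePt`); COVER from the raw cover clauses through H4-1″ `beltLevel_dichotomy`
(level `0`) and H4-1′ `seam_of_offCritical` (`0 < |σ| < η ≤` gap).  Also landed: the single-hypothesis EXISTENCE form
`N1Mono_of_flowChartInteger` (text `FlowChartIntegerStatement`, what the blow-up route produces), from which the
contract follows, and `chartPoint_offCores_box` / `level_eq_of_ray_eq` for the assembler.  Everything here is proved;
the pieces enter as hypotheses; no `sorry`, no definitions.  References: R. E. Gompf, A. I. Stipsicz, *4-Manifolds and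
Kirby Calculus* (1999), §8.2 [GompfStipsicz1999]; A. A. Kosinski, *Differential Manifolds* (1993), VI §6 [Kosinski1993].
-/

noncomputable section

set_option linter.dupNamespace false

open scoped Manifold ContDiff Topology Real
open Set Function

namespace Summit.SmoothPoincare4.SmoothPoincare4.Theorems.AcyclicBisectionExists.ModpBraidOrbits

open Literature.Topology.FourManifolds Literature.Topology.FourManifolds.LefschetzBase
open Literature.Topology.FourManifolds.HandleAttachingMap

/-! ## §1 Chart points off the cores -/

/-- **Sub-goal `helper_chartPoint_offCores`**: if the cores lie in the pages of the directions `d j` and `e` is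
the direction of no handle, every point of the page of direction `e` is off the cores (distinct directions have
disjoint pages). [folklore] -/
theorem helper_chartPoint_offCores : ∀ (g n : ℕ) (h : Fin n → Literature.Topology.FourManifolds.HandleAttachingMap 3 2 (Literature.Topology.FourManifolds.LefschetzBase.Base g)) (d : Fin n → ℂ) (e : ℂ) (a : Literature.Topology.FourManifolds.LefschetzBase.Base g), (∀ j θ, (h j).attachingCircle θ ∈ Literature.Topology.FourManifolds.LefschetzBase.page g (d j)) → (∀ j, d j ≠ e) → a ∈ Literature.Topology.FourManifolds.LefschetzBase.page g e → a ∈ Literature.Topology.FourManifolds.HandleAttachingMap.coresComplement h := by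
  intro g n h d e a hpg hne ha
  rw [mem_coresComplement]
  intro j hj
  rw [← range_attachingCircle] at hj
  obtain ⟨θ, rfl⟩ := hj
  exact Set.disjoint_left.1 (disjoint_page g (hne j)) (hpg j θ) ha

/-- **Chart points of the box off the cores, WITHOUT an angle gap** (for the assembler of the glued chart):
for `|r| < 1`, `|σ| ≤ η₁`, `|σ| < 2π` and `(r, σ) ≠ (0, 0)` the chart point `φ (u, r, σ)` is off every core — off
the core of `k` because its page differs (`σ ≠ 0`) or by injectivity at the belt level (`σ = 0`, `r ≠ 0`), off
the other cores because attaching maps have pairwise disjoint ranges. [cite: Kosinski1993, VI §6] -/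
theorem chartPoint_offCores_box {g n : ℕ} {h : Fin n → HandleAttachingMap 3 2 (Base g)}
    {X : Type} [TopologicalSpace X] [ChartedSpace (EuclideanHalfSpace 4) X]
    (D : MultiAttachmentData h (𝓡∂ 4) X) {d : Fin n → ℂ} {k : Fin n} {η₁ : ℝ} {φ : ℝ × ℝ × ℝ → Base g}
    (hd : ‖d k‖ = 1) (hpg : ∀ θ, (h k).attachingCircle θ ∈ page g (d k))
    (hφper : ∀ u r σ, φ (u + 1, r, σ) = φ (u, r, σ))
    (hφcore : ∀ u, φ (u, 0, 0) = (h k).attachingCircle (circlePt u))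
    (hφpage : ∀ u r σ, σ ∈ Set.Icc (-η₁) η₁ → φ (u, r, σ) ∈ page g (d k * Complex.exp ((σ : ℂ) * Complex.I)))
    (hφrange : ∀ u r σ, r ∈ Set.Ioo (-1 : ℝ) 1 → σ ∈ Set.Icc (-η₁) η₁ → φ (u, r, σ) ∈ range (h k).toFun)
    (hφinj : ∀ σ ∈ Set.Icc (-η₁) η₁,
      Set.InjOn (fun p : ℝ × ℝ => φ (p.1, p.2, σ)) (Set.Ico (0 : ℝ) 1 ×ˢ Set.Ioo (-1 : ℝ) 1))
    {u r σ : ℝ} (hr : r ∈ Set.Ioo (-1 : ℝ) 1) (hσ : σ ∈ Set.Icc (-η₁) η₁) (hσπ : |σ| < 2 * Real.pi)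
    (hne : σ ≠ 0 ∨ r ≠ 0) : φ (u, r, σ) ∈ coresComplement h := by
  rw [mem_coresComplement]
  intro j hj
  by_cases hjk : j = k
  · subst hjk
    rw [← range_attachingCircle] at hj
    obtain ⟨θ, hθ⟩ := hj
    by_cases hσ0 : σ = 0
    · -- the belt level (`r ≠ 0`): injectivity on the fundamental domain
      subst hσ0
      have hr0 : r ≠ 0 := hne.resolve_left (fun h0 => h0 rfl)
      have e1 : φ (angA θ, 0, 0) = φ (u, r, 0) := by rw [hφcore, circlePt_angA, hθ]
      have ep : ∀ u r σ, φ (Int.fract u, r, σ) = φ (u, r, σ) := fun u r σ => by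
        have h1 := BeltReturn.periodic_int_shift hφper (-⌊u⌋) u r σ
        rw [show u + ((-⌊u⌋ : ℤ) : ℝ) = Int.fract u by rw [Int.fract]; push_cast; ring] at h1
        exact h1
      have e2 : (fun p : ℝ × ℝ => φ (p.1, p.2, 0)) (Int.fract (angA θ), 0) =
          (fun p : ℝ × ℝ => φ (p.1, p.2, 0)) (Int.fract u, r) := by
        simp only
        rw [ep, ep, e1]
      have h3 := hφinj 0 hσ ⟨⟨Int.fract_nonneg _, Int.fract_lt_one _⟩, by norm_num⟩
        ⟨⟨Int.fract_nonneg _, Int.fract_lt_one _⟩, hr⟩ e2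
      exact hr0 (congrArg Prod.snd h3).symm
    · -- off the belt level: the page of the level differs from the page of the core
      have hne' : d j ≠ d j * Complex.exp ((σ : ℂ) * Complex.I) := by
        intro he
        have hdj : d j ≠ 0 := norm_ne_zero_iff.1 (by rw [hd]; norm_num)
        have h1 : Complex.exp ((σ : ℂ) * Complex.I) = 1 := by
          nth_rw 1 [← mul_one (d j)] at he
          exact (mul_left_cancel₀ hdj he).symm
        exact exp_ofReal_mul_I_ne_one hσ0 hσπ h1
      exact Set.disjoint_left.1 (disjoint_page g hne') (hpg θ) (hθ ▸ hφpage u r σ hσ)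
  · -- another handle: the attaching maps have disjoint ranges
    have h1 : φ (u, r, σ) ∈ range (h j).toFun := by
      obtain ⟨y, -, hy⟩ := hj
      exact ⟨y, hy⟩
    exact Set.disjoint_left.1 (D.disjoint hjk) h1 (hφrange u r σ hr hσ)

/-- **The level is determined by the ray**: two positive multiples of `d k · e^{iσ}`, `d k · e^{iσ'}`
(`‖d k‖ = 1`, `|σ|, |σ'| < π`) agree only if `σ = σ'`. [folklore] -/
theorem level_eq_of_ray_eq {dk : ℂ} (hdk : ‖dk‖ = 1) {σ σ' c c' : ℝ} (hc : 0 < c) (hc' : 0 < c')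
    (hσ : |σ| < Real.pi) (hσ' : |σ'| < Real.pi)
    (he : (c : ℂ) * (dk * Complex.exp ((σ : ℂ) * Complex.I)) =
      (c' : ℂ) * (dk * Complex.exp ((σ' : ℂ) * Complex.I))) : σ = σ' := by
  have hn : ∀ τ : ℝ, ‖dk * Complex.exp ((τ : ℂ) * Complex.I)‖ = 1 := fun τ => by
    rw [norm_mul, hdk, Complex.norm_exp_ofReal_mul_I, mul_one]
  have h1 := eq_of_pos_mul_unit_eq hc hc' (hn σ) (hn σ') he
  have hdk0 : dk ≠ 0 := norm_ne_zero_iff.1 (by rw [hdk]; norm_num)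
  have h2 : Complex.exp ((σ : ℂ) * Complex.I) = Complex.exp ((σ' : ℂ) * Complex.I) :=
    mul_left_cancel₀ hdk0 h1
  have h3 : Complex.exp (((σ - σ' : ℝ) : ℂ) * Complex.I) = 1 := by
    have h4 : Complex.exp ((σ' : ℂ) * Complex.I) ≠ 0 := Complex.exp_ne_zero _
    rw [show ((σ - σ' : ℝ) : ℂ) * Complex.I = (σ : ℂ) * Complex.I - (σ' : ℂ) * Complex.I by
      push_cast; ring, Complex.exp_sub, h2, div_self h4]
  by_contra hne
  have hlt : |σ - σ'| < 2 * Real.pi := by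
    have := abs_sub σ σ'
    linarith
  exact exp_ofReal_mul_I_ne_one (sub_ne_zero.2 hne) hlt h3

/-! ## §2 (d) from the glued chart with raw clauses and the raw displacement (existence form) -/

set_option maxHeartbeats 800000 in
-- two ∀-texts of ~45 binders; the destructuring and the final `refine` are large
/-- **(d) from ONE hypothesis**: the glued chart with raw clauses together with its raw displacement
(`J3Interface.FlowChartIntegerStatement`, the form produced by the blow-up route of (d9)) implies
`H4Interface.N1MonoStatement` VERBATIM. [cite: GompfStipsicz1999, §8.2] -/
theorem N1Mono_of_flowChartInteger
    (H : ∀ (g n : ℕ) (X₀ : Type) [TopologicalSpace X₀] [T2Space X₀] [SecondCountableTopology X₀] [CompactSpace X₀] [ChartedSpace (EuclideanHalfSpace 4) X₀] [IsManifold (𝓡∂ 4) ∞ X₀] (bX : BoundaryData (𝓡∂ 4) X₀ (𝓡 3)) (Ψ : bX.carrier ≃ₘ⟮𝓡 3, 𝓡 3⟯ (bBase g).carrier) (X : Type) [TopologicalSpace X] [T2Space X] [SecondCountableTopology X] [CompactSpace X] [ChartedSpace (EuclideanHalfSpace 4) X] [IsManifold (𝓡∂ 4) ∞ X] (G₀ :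 X₀ ≃ₘ⟮𝓡∂ 4, 𝓡∂ 4⟯ X) (h : Fin n → HandleAttachingMap 3 2 (Base g)) (D : MultiAttachmentData h (𝓡∂ 4) X) (d : Fin n → ℂ) (k : Fin n) (s : Bool), (∀ j, ‖d j‖ = 1) → (∀ j θ, (h j).attachingCircle θ ∈ page g (d j)) → (∀ j, j ≠ k → d j ≠ d k) → (pageTwisting g (h k).attachingCircle (h k).attachingFraming = if s then -1 else 1) → (∀ (y : bX.carrier) (a : ↥(coresComplement h)), G₀ (bX.incl y) = D.jA a → ∃ c : ℝ, 0 < c ∧ w g ((bBase g).incl (Ψ y)).1 = (c : ℂ) * w g (a : Base g).1) → (∀ (y : bX.carrier) (j : Fin n) (b : ↥(beltPiece 3 2)), G₀ (bX.incl y) = D.jB j b → G₀ (bX.incl y) ∉ range D.jA → ∃ c : ℝ, 0 < c ∧ w g ((bBase g).incl (Ψ y)).1 = (c : ℂ) * d j) → ∀ (η₁ : ℝ) (φ : ℝ × ℝ × ℝ → Base g), 0 < η₁ → ContMDiff 𝓘(ℝ, ℝ × ℝ × ℝ) (𝓡∂ 4) ∞ φ → (∀ u r σ, φ (u + 1, r,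 σ) = φ (u, r, σ)) → (∀ u, φ (u, 0, 0) = (h k).attachingCircle (circlePt u)) → (∀ u r σ, σ ∈ Set.Icc (-η₁) η₁ → φ (u, r, σ) ∈ page g (d k * Complex.exp ((σ : ℂ) * Complex.I))) → (∀ u r σ, r ∈ Set.Ioo (-1 : ℝ) 1 → σ ∈ Set.Icc (-η₁) η₁ → φ (u, r, σ) ∈ range (h k).toFun) → (∀ σ ∈ Set.Icc (-η₁) η₁, Set.InjOn (fun p : ℝ × ℝ => φ (p.1, p.2, σ)) (Set.Ico (0 : ℝ) 1 ×ˢ Set.Ioo (-1 : ℝ) 1)) → (∀ u r σ, r ∈ Set.Ioo (-1 : ℝ) 1 → σ ∈ Set.Icc (-η₁) η₁ → 0 < inner ℝ (deriv (fun r' => (φ (u, r', σ)).1) r) (cplxJ (deriv (fun u' => (φ (u', r, σ)).1) u))) → ∀ η₂ : ℝ, 0 < η₂ → ∃ (η : ℝ) (Λ : ℝ × ℝ × ℝ → bX.carrier) (G₁ : ℝ × ℝ → ℝ × ℝ), 0 < η ∧ η ≤ η₁ ∧ η ≤ η₂ ∧ (∀ u r r', r ∈ Set.Ico (1 / 2 :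 ℝ) 1 → r' ∈ Set.Ioc (-1 : ℝ) (-(1 / 2)) → (G₁ (u, r)).1 - (G₁ (u, r')).1 = if s then 1 else -1) ∧ ContMDiffOn 𝓘(ℝ, ℝ × ℝ × ℝ) (𝓡 3) ∞ Λ (Set.univ ×ˢ (Set.Ioo (-1 : ℝ) 1 ×ˢ Set.Ioo (-η) η)) ∧ (∀ p ∈ Set.univ ×ˢ (Set.Ioo (-1 : ℝ) 1 ×ˢ Set.Ioo (-η) η), Function.Injective (mfderiv 𝓘(ℝ, ℝ × ℝ × ℝ) (𝓡 3) Λ p)) ∧ Set.InjOn Λ (Set.Ico (0 : ℝ) 1 ×ˢ (Set.Ioo (-1 : ℝ) 1 ×ˢ Set.Ioo (-η) η)) ∧ (∀ u r σ, Λ (u + 1, r, σ) = Λ (u, r, σ)) ∧ (∀ u r σ, r ∈ Set.Ioo (-1 : ℝ) 1 → σ ∈ Set.Ioo (-η) η → ∃ c : ℝ, 0 < c ∧ w g ((bBase g).incl (Ψ (Λ (u, r, σ)))).1 = (c : ℂ) * (d k * Complex.exp ((σ : ℂ) * Complex.I))) ∧ (∀ u r σ, r ∈ Set.Ioo (-1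 : ℝ) 1 → σ ∈ Set.Ioo (-η) η → (σ ≤ -(η / 2) ∨ 1 / 2 ≤ |r|) → ∃ a : ↥(coresComplement h), (a : Base g) = φ (u, r, σ) ∧ G₀ (bX.incl (Λ (u, r, σ))) = D.jA a) ∧ ContDiffOn ℝ ∞ G₁ (Set.univ ×ˢ Set.Ioo (-1 : ℝ) 1) ∧ (∀ u r σ, r ∈ Set.Ioo (-1 : ℝ) 1 → η / 2 ≤ σ → σ < η → (G₁ (u, r)).2 ∈ Set.Ioo (-1 : ℝ) 1 ∧ ∃ a : ↥(coresComplement h), (a : Base g) = φ ((G₁ (u, r)).1, (G₁ (u, r)).2, σ) ∧ G₀ (bX.incl (Λ (u, r, σ))) = D.jA a) ∧ (∀ u r σ, r ∈ Set.Ioo (-1 : ℝ) 1 → σ ∈ Set.Ioo (-η) η → (∃ u' r', r' ∈ Set.Ioo (-1 : ℝ) 1 ∧ ∃ a : ↥(coresComplement h), (a : Base g) = φ (u', r', σ) ∧ G₀ (bX.incl (Λ (u, r, σ))) = D.jA a) ∨ (σ = 0 ∧ ∃ θ : Metric.sphere (0 : EuclideanSpace ℝ (Fin 2)) 1, G₀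 (bX.incl (Λ (u, r, σ))) = D.jB k (beltCirclePt θ))) ∧ (∀ (y : bX.carrier) (σ : ℝ), σ ∈ Set.Ioo (-η) η → ∀ a : ↥(coresComplement h), G₀ (bX.incl y) = D.jA a → (a : Base g) ∈ (fun p : ℝ × ℝ => φ (p.1, p.2, σ)) '' (Set.univ ×ˢ Set.Icc (-(1 / 2) : ℝ) (1 / 2)) → ∃ u r, r ∈ Set.Ioo (-1 : ℝ) 1 ∧ Λ (u, r, σ) = y) ∧ (∀ (y : bX.carrier) (θ : Metric.sphere (0 : EuclideanSpace ℝ (Fin 2)) 1), G₀ (bX.incl y) = D.jB k (beltCirclePt θ) → ∃ u r, r ∈ Set.Ioo (-1 : ℝ) 1 ∧ Λ (u, r, 0) = y)) :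
    ∀ (g n : ℕ) (X₀ : Type) [TopologicalSpace X₀] [T2Space X₀] [SecondCountableTopology X₀] [CompactSpace X₀] [ChartedSpace (EuclideanHalfSpace 4) X₀] [IsManifold (𝓡∂ 4) ∞ X₀] (bX : BoundaryData (𝓡∂ 4) X₀ (𝓡 3)) (Ψ : bX.carrier ≃ₘ⟮𝓡 3, 𝓡 3⟯ (bBase g).carrier) (X : Type) [TopologicalSpace X] [T2Space X] [SecondCountableTopology X] [CompactSpace X] [ChartedSpace (EuclideanHalfSpace 4) X] [IsManifold (𝓡∂ 4) ∞ X] (G₀ : X₀ ≃ₘ⟮𝓡∂ 4, 𝓡∂ 4⟯ X) (h : Fin n → HandleAttachingMap 3 2 (Base g)) (D : MultiAttachmentData h (𝓡∂ 4) X) (d : Fin n → ℂ) (k : Fin n) (s : Bool), (∀ j, ‖d j‖ = 1) → (∀ j θ, (h j).attachingCircle θ ∈ page g (d j)) → (∀ j, j ≠ k → d j ≠ d k) → (pageTwisting g (h k).attachingCircle (h k).attachingFraming = if s then -1 else 1) → (∀ (y : bX.carrier) (a : ↥(coresComplement h)), G₀ (bX.incl y) = D.jA a → ∃ c : ℝ,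 0 < c ∧ w g ((bBase g).incl (Ψ y)).1 = (c : ℂ) * w g (a : Base g).1) → (∀ (y : bX.carrier) (j : Fin n) (b : ↥(beltPiece 3 2)), G₀ (bX.incl y) = D.jB j b → G₀ (bX.incl y) ∉ range D.jA → ∃ c : ℝ, 0 < c ∧ w g ((bBase g).incl (Ψ y)).1 = (c : ℂ) * d j) → ∀ (η₁ : ℝ) (φ : ℝ × ℝ × ℝ → Base g), 0 < η₁ → ContMDiff 𝓘(ℝ, ℝ × ℝ × ℝ) (𝓡∂ 4) ∞ φ → (∀ u r σ, φ (u + 1, r, σ) = φ (u, r, σ)) → (∀ u, φ (u, 0, 0) = (h k).attachingCircle (circlePt u)) → (∀ u r σ, σ ∈ Set.Icc (-η₁) η₁ → φ (u, r, σ) ∈ page g (d k * Complex.exp ((σ : ℂ) * Complex.I))) → (∀ u r σ, r ∈ Set.Ioo (-1 : ℝ) 1 → σ ∈ Set.Icc (-η₁) η₁ → φ (u, r, σ) ∈ range (h k).toFun) → (∀ σ ∈ Set.Icc (-η₁) η₁, Set.InjOn (fun p : ℝ × ℝ => φ (p.1, p.2, σ)) (Set.Ico (0 : ℝ) 1 ×ˢ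 Set.Ioo (-1 : ℝ) 1)) → (∀ u r σ, r ∈ Set.Ioo (-1 : ℝ) 1 → σ ∈ Set.Icc (-η₁) η₁ → 0 < inner ℝ (deriv (fun r' => (φ (u, r', σ)).1) r) (cplxJ (deriv (fun u' => (φ (u', r, σ)).1) u))) → ∃ (η : ℝ) (G : ℝ × ℝ → ℝ × ℝ) (Λ : ℝ × ℝ × ℝ → bX.carrier), 0 < η ∧ η ≤ η₁ ∧ ContDiff ℝ ∞ G ∧ (∀ u r, G (u + 1, r) = G (u, r) + (1, 0)) ∧ (∀ u r, r ≤ -(1 / 2 : ℝ) → G (u, r) = (u, r)) ∧ (∀ u r, (1 / 2 : ℝ) ≤ r → G (u, r) = (u + (if s then 1 else -1), r)) ∧ (∀ u r, r ∈ Set.Ioo (-1 : ℝ) 1 → (G (u, r)).2 ∈ Set.Ioo (-1 : ℝ) 1) ∧ ContMDiffOn 𝓘(ℝ, ℝ × ℝ × ℝ) (𝓡 3) ∞ Λ (Set.univ ×ˢ (Set.Ioo (-1 : ℝ) 1 ×ˢ Set.Ioo (-η) η)) ∧ (∀ p ∈ Set.univ ×ˢ (Set.Ioo (-1 : ℝ)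 1 ×ˢ Set.Ioo (-η) η), Function.Injective (mfderiv 𝓘(ℝ, ℝ × ℝ × ℝ) (𝓡 3) Λ p)) ∧ Set.InjOn Λ (Set.Ico (0 : ℝ) 1 ×ˢ (Set.Ioo (-1 : ℝ) 1 ×ˢ Set.Ioo (-η) η)) ∧ (∀ u r σ, Λ (u + 1, r, σ) = Λ (u, r, σ)) ∧ (∀ u r σ, r ∈ Set.Ioo (-1 : ℝ) 1 → σ ∈ Set.Ioo (-η) η → ∃ c : ℝ, 0 < c ∧ w g ((bBase g).incl (Ψ (Λ (u, r, σ)))).1 = (c : ℂ) * (d k * Complex.exp ((σ : ℂ) * Complex.I))) ∧ (∀ u r σ, r ∈ Set.Ioo (-1 : ℝ) 1 → σ ∈ Set.Ioo (-η) η → (σ ≤ -(η / 2) ∨ 1 / 2 ≤ |r|) → ∃ a : ↥(coresComplement h), (a : Base g) = φ (u, r, σ) ∧ G₀ (bX.incl (Λ (u, r, σ))) = D.jA a) ∧ (∀ u r σ, r ∈ Set.Ioo (-1 : ℝ) 1 → η / 2 ≤ σ → σ < η → ∃ a : ↥(coresComplement h), (a : Base g) = φ ((G (u, r)).1, (G (u,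 r)).2, σ) ∧ G₀ (bX.incl (Λ (u, r, σ))) = D.jA a) ∧ (∀ u r σ, r ∈ Set.Ioo (-1 : ℝ) 1 → σ ∈ Set.Ioo (-η) η → (∃ u' r', r' ∈ Set.Ioo (-1 : ℝ) 1 ∧ ∃ a : ↥(coresComplement h), (a : Base g) = φ (u', r', σ) ∧ G₀ (bX.incl (Λ (u, r, σ))) = D.jA a) ∨ (σ = 0 ∧ (∀ a : ↥(coresComplement h), G₀ (bX.incl (Λ (u, r, σ))) ≠ D.jA a) ∧ ∃ b : ↥(beltPiece 3 2), G₀ (bX.incl (Λ (u, r, σ))) = D.jB k b)) ∧ (∀ (y : bX.carrier) (σ : ℝ), σ ∈ Set.Ioo (-η) η → (∃ c : ℝ, 0 < c ∧ w g ((bBase g).incl (Ψ y)).1 = (c : ℂ) * (d k * Complex.exp ((σ : ℂ) * Complex.I))) → (∃ u r, r ∈ Set.Ioo (-1 : ℝ) 1 ∧ Λ (u, r, σ) = y) ∨ (∃ a : ↥(coresComplement h), G₀ (bX.incl y) = D.jA a ∧ (a : Base g) ∉ (fun p : ℝ × ℝ => φ (p.1, p.2, σ)) '' (Set.univ ×ˢ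 Set.Icc (-(1 / 2) : ℝ) (1 / 2)))) := by
  intro g n X₀ _ _ _ _ _ _ bX Ψ X _ _ _ _ _ _ G₀ h D d k s hd hpg hdir htw hseam hbelt η₁ φ hη₁ hφ hφper
    hφcore hφpage hφrange hφinj hφor
  -- the angle gap of H4-1′, prescribed as the bound `η₂`
  obtain ⟨η₀, hη₀, -, hgap⟩ := exists_angle_gap d k hd hdir
  obtain ⟨η, Λ, G₁, hη, hηη₁, hηη₀, hdisp, hΛsm, hΛimm, hΛinj, hΛper, hfib, hbs, hG₁, habove, himage,
    hcovS, hcovB⟩ := H g n X₀ bX Ψ X G₀ h D d k s hd hpg hdir htw hseam hbelt η₁ φ hη₁ hφ hφper hφcore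
    hφpage hφrange hφinj hφor η₀ hη₀
  have hlev : ∀ σ : ℝ, ‖d k * Complex.exp ((σ : ℂ) * Complex.I)‖ = 1 := fun σ => by
    rw [norm_mul, hd k, Complex.norm_exp_ofReal_mul_I, mul_one]
  have hIcc : ∀ σ : ℝ, σ ∈ Set.Ioo (-η) η → σ ∈ Set.Icc (-η₁) η₁ := fun σ hσ =>
    ⟨by linarith [hσ.1], by linarith [hσ.2]⟩
  -- chart points off the belt level are off the cores
  have hoffσ : ∀ u r σ, σ ∈ Set.Ioo (-η) η → σ ≠ 0 → φ (u, r, σ) ∈ coresComplement h :=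
    fun u r σ hσ hσ0 => helper_chartPoint_offCores g n h d _ _ hpg
      (hgap σ hσ0 ((abs_lt.2 ⟨hσ.1, hσ.2⟩).trans_le hηη₀)) (hφpage u r σ (hIcc σ hσ))
  have hησ : ∀ σ : ℝ, η / 2 ≤ σ → σ < η → σ ∈ Set.Ioo (-η) η ∧ σ ≠ 0 := fun σ h1 h2 =>
    ⟨⟨by linarith, h2⟩, by intro h0; subst h0; linarith⟩
  -- the point-set seam family over the chart, valued in `X` (an extension of `D.jA ∘ φ`)
  classical
  let jAx : Base g → X := fun a =>
    if ha : a ∈ coresComplement h then D.jA ⟨a, ha⟩ else G₀ (bX.incl (Λ 0))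
  have hjAx : ∀ (a : Base g) (ha : a ∈ coresComplement h), jAx a = D.jA ⟨a, ha⟩ := fun a ha => dif_pos ha
  have hjAx' : ∀ a : ↥(coresComplement h), jAx a = D.jA a := fun a => by rw [hjAx a a.2]
  -- the return map: J3's normalisation of the raw coordinate map
  obtain ⟨n₀, m, G, hGsm, hGeqv, hGlow, hGup, hGr, hGabove, hGG₁⟩ := helper_beltReturnMap X
    (fun p => G₀ (bX.incl (Λ p))) (fun p => jAx (φ p)) η G₁ hη hG₁
    (fun u r σ => by show jAx (φ (u + 1, r, σ)) = jAx (φ (u, r, σ)); rw [hφper])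
    (fun u r σ => by show G₀ (bX.incl (Λ (u + 1, r, σ))) = G₀ (bX.incl (Λ (u, r, σ))); rw [hΛper])
    (by
      rintro ⟨pu, pr⟩ hp ⟨qu, qr⟩ hq he
      have h2 : η / 2 ∈ Set.Ioo (-η) η := ⟨by linarith, by linarith⟩
      have h2' : (η / 2 : ℝ) ≠ 0 := by positivity
      have hoffp := hoffσ pu pr (η / 2) h2 h2'
      have hoffq := hoffσ qu qr (η / 2) h2 h2'
      have he' : jAx (φ (pu, pr, η / 2)) = jAx (φ (qu, qr, η / 2)) := he
      rw [hjAx _ hoffp, hjAx _ hoffq] at he'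
      have h3 := congrArg Subtype.val (D.injective_jA he')
      exact hφinj (η / 2) (hIcc _ h2) hp hq h3)
    (fun u r hr => (habove u r (η / 2) hr le_rfl (by linarith)).1)
    (fun u r σ hr h1 h2 => by
      obtain ⟨-, a, ha, hΛa⟩ := habove u r σ hr h1 h2
      show G₀ (bX.incl (Λ (u, r, σ))) = jAx (φ ((G₁ (u, r)).1, (G₁ (u, r)).2, σ))
      rw [hΛa, ← ha, hjAx' a])
    (fun u r σ hr hrs h1 h2 => by
      obtain ⟨a, ha, hΛa⟩ := hbs u r σ hr (hησ σ h1 h2).1 (Or.inr hrs)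
      show G₀ (bX.incl (Λ (u, r, σ))) = jAx (φ (u, r, σ))
      rw [hΛa, ← ha, hjAx' a])
  -- the integer: raw displacement (hypothesis) = `n₀` (side identities of `G`)
  have hn₀ : ((n₀ : ℤ) : ℝ) = if s then 1 else -1 := by
    have e1 := hGup 0 (3 / 4) (by norm_num)
    have e2 := hGlow 0 (-(3 / 4)) (by norm_num)
    have e3 := hGG₁ 0 (3 / 4) (by norm_num)
    have e4 := hGG₁ 0 (-(3 / 4)) (by norm_num)
    have e5 := hdisp 0 (3 / 4) (-(3 / 4)) (by norm_num) (by norm_num)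
    have f1 := congrArg Prod.fst (e1.symm.trans e3)
    have f2 := congrArg Prod.fst (e2.symm.trans e4)
    simp only [Prod.fst_sub] at f1 f2
    rw [← e5]
    linarith
  refine ⟨η, G, Λ, hη, hηη₁, hGsm, hGeqv, hGlow, fun u r hr => by rw [hGup u r hr, hn₀], hGr, hΛsm,
    hΛimm, hΛinj, hΛper, hfib, hbs, ?_, ?_, ?_⟩
  · -- ABOVE: plain seam over the chart coordinates twisted by `G`
    intro u r σ hr h1 h2
    have hoffp : φ ((G (u, r)).1, (G (u, r)).2, σ) ∈ coresComplement h :=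
      hoffσ _ _ σ (hησ σ h1 h2).1 (hησ σ h1 h2).2
    refine ⟨⟨_, hoffp⟩, rfl, ?_⟩
    have h3 : G₀ (bX.incl (Λ (u, r, σ))) = jAx (φ ((G (u, r)).1, (G (u, r)).2, σ)) :=
      hGabove u r σ hr h1 h2
    rw [h3, hjAx _ hoffp]
  · -- IMAGE
    intro u r σ hr hσ
    rcases himage u r σ hr hσ with h1 | ⟨hσ0, θ, hθ⟩
    · exact Or.inl h1
    · exact Or.inr ⟨hσ0, fun a ha => jA_ne_jB_beltCirclePt D k a θ (ha.symm.trans hθ), beltCirclePt θ, hθ⟩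
  · -- COVER: the dichotomy over the arc of angles
    intro y σ hσ hwy
    have seam_case : ∀ a : ↥(coresComplement h), G₀ (bX.incl y) = D.jA a →
        (∃ u r, r ∈ Set.Ioo (-1 : ℝ) 1 ∧ Λ (u, r, σ) = y) ∨
        (∃ a : ↥(coresComplement h), G₀ (bX.incl y) = D.jA a ∧
          (a : Base g) ∉ (fun p : ℝ × ℝ => φ (p.1, p.2, σ)) ''
            (Set.univ ×ˢ Set.Icc (-(1 / 2) : ℝ) (1 / 2))) := by
      intro a hya
      by_cases hin : (a : Base g) ∈ (fun p : ℝ × ℝ => φ (p.1, p.2, σ)) ''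
          (Set.univ ×ˢ Set.Icc (-(1 / 2) : ℝ) (1 / 2))
      · exact Or.inl (hcovS y σ hσ a hya hin)
      · exact Or.inr ⟨a, hya, hin⟩
    by_cases hσ0 : σ = 0
    · subst hσ0
      have hwy' : ∃ c : ℝ, 0 < c ∧ w g ((bBase g).incl (Ψ y)).1 = (c : ℂ) * d k := by
        simpa using hwy
      rcases beltLevel_dichotomy bX Ψ G₀ D d hseam hbelt hd k hdir y hwy' with ⟨a, hya, -, -⟩ | ⟨θ, hyθ, -⟩
      · exact seam_case a hya
      · exact Or.inl (hcovB y θ hyθ)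
    · obtain ⟨a, hya, -, -⟩ := seam_of_offCritical bX Ψ G₀ D d hseam hbelt hd (hlev σ)
        (hgap σ hσ0 ((abs_lt.2 ⟨hσ.1, hσ.2⟩).trans_le hηη₀)) y hwy
      exact seam_case a hya

/-! ## §3 The contract -/

set_option maxHeartbeats 800000 in
-- three ∀-texts of ~45 binders
/-- **THE ASSEMBLY CONTRACT of piece (d)** — `H4Interface.N1MonoStatement` VERBATIM from the glued chart with
raw clauses (`HΛ`, text `J3Interface.FlowChartStatement`: (d7) assembled on J1's flow package) and the integer
in uniqueness form (`Hn`, text `J3Interface.IntegerStatement`: (d9)).  With both landed,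
`helper_N1_beltMonodromy := helper_N1_beltMonodromy_of_pieces HΛ Hn` closes (d), and then
`node_N1_move := node_N1_move_of_pieces HC1 HC2 (piece_e_cross helper_N1_beltMonodromy) HE`.
[cite: GompfStipsicz1999, §8.2] -/
theorem helper_N1_beltMonodromy_of_pieces
    (HΛ : ∀ (g n : ℕ) (X₀ : Type) [TopologicalSpace X₀] [T2Space X₀] [SecondCountableTopology X₀] [CompactSpace X₀] [ChartedSpace (EuclideanHalfSpace 4) X₀] [IsManifold (𝓡∂ 4) ∞ X₀] (bX : BoundaryData (𝓡∂ 4) X₀ (𝓡 3)) (Ψ : bX.carrier ≃ₘ⟮𝓡 3, 𝓡 3⟯ (bBase g).carrier) (X : Type) [TopologicalSpace X] [T2Space X] [SecondCountableTopology X] [CompactSpace X] [ChartedSpace (EuclideanHalfSpace 4) X] [IsManifold (𝓡∂ 4) ∞ X] (G₀ : X₀ ≃ₘ⟮𝓡∂ 4, 𝓡∂ 4⟯ X) (h : Fin n → HandleAttachingMap 3 2 (Base g)) (D : MultiAttachmentData h (𝓡∂ 4) X) (d : Fin n → ℂ) (k : Fin n) (s : Bool), (∀ j, ‖d j‖ =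 1) → (∀ j θ, (h j).attachingCircle θ ∈ page g (d j)) → (∀ j, j ≠ k → d j ≠ d k) → (pageTwisting g (h k).attachingCircle (h k).attachingFraming = if s then -1 else 1) → (∀ (y : bX.carrier) (a : ↥(coresComplement h)), G₀ (bX.incl y) = D.jA a → ∃ c : ℝ, 0 < c ∧ w g ((bBase g).incl (Ψ y)).1 = (c : ℂ) * w g (a : Base g).1) → (∀ (y : bX.carrier) (j : Fin n) (b : ↥(beltPiece 3 2)), G₀ (bX.incl y) = D.jB j b → G₀ (bX.incl y) ∉ range D.jA → ∃ c : ℝ, 0 < c ∧ w g ((bBase g).incl (Ψ y)).1 = (c : ℂ) * d j) → ∀ (η₁ : ℝ) (φ : ℝ × ℝ × ℝ → Base g), 0 < η₁ → ContMDiff 𝓘(ℝ, ℝ × ℝ × ℝ) (𝓡∂ 4) ∞ φ → (∀ u r σ, φ (u + 1, r, σ) = φ (u, r, σ)) → (∀ u, φ (u, 0, 0) = (h k).attachingCircle (circlePt u)) → (∀ u r σ, σ ∈ Set.Icc (-η₁) η₁ → φ (u, r, σ) ∈ page g (d k * Complex.exp ((σ : ℂ) * Complex.I))) → (∀ u r σ,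 r ∈ Set.Ioo (-1 : ℝ) 1 → σ ∈ Set.Icc (-η₁) η₁ → φ (u, r, σ) ∈ range (h k).toFun) → (∀ σ ∈ Set.Icc (-η₁) η₁, Set.InjOn (fun p : ℝ × ℝ => φ (p.1, p.2, σ)) (Set.Ico (0 : ℝ) 1 ×ˢ Set.Ioo (-1 : ℝ) 1)) → (∀ u r σ, r ∈ Set.Ioo (-1 : ℝ) 1 → σ ∈ Set.Icc (-η₁) η₁ → 0 < inner ℝ (deriv (fun r' => (φ (u, r', σ)).1) r) (cplxJ (deriv (fun u' => (φ (u', r, σ)).1) u))) → ∀ η₂ : ℝ, 0 < η₂ → ∃ (η : ℝ) (Λ : ℝ × ℝ × ℝ → bX.carrier) (G₁ : ℝ × ℝ → ℝ × ℝ), 0 < η ∧ η ≤ η₁ ∧ η ≤ η₂ ∧ ContMDiffOn 𝓘(ℝ, ℝ × ℝ × ℝ) (𝓡 3) ∞ Λ (Set.univ ×ˢ (Set.Ioo (-1 : ℝ) 1 ×ˢ Set.Ioo (-η) η)) ∧ (∀ p ∈ Set.univ ×ˢ (Set.Ioo (-1 : ℝ) 1 ×ˢ Set.Ioo (-η) η),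 Function.Injective (mfderiv 𝓘(ℝ, ℝ × ℝ × ℝ) (𝓡 3) Λ p)) ∧ Set.InjOn Λ (Set.Ico (0 : ℝ) 1 ×ˢ (Set.Ioo (-1 : ℝ) 1 ×ˢ Set.Ioo (-η) η)) ∧ (∀ u r σ, Λ (u + 1, r, σ) = Λ (u, r, σ)) ∧ (∀ u r σ, r ∈ Set.Ioo (-1 : ℝ) 1 → σ ∈ Set.Ioo (-η) η → ∃ c : ℝ, 0 < c ∧ w g ((bBase g).incl (Ψ (Λ (u, r, σ)))).1 = (c : ℂ) * (d k * Complex.exp ((σ : ℂ) * Complex.I))) ∧ (∀ u r σ, r ∈ Set.Ioo (-1 : ℝ) 1 → σ ∈ Set.Ioo (-η) η → (σ ≤ -(η / 2) ∨ 1 / 2 ≤ |r|) → ∃ a : ↥(coresComplement h), (a : Base g) = φ (u, r, σ) ∧ G₀ (bX.incl (Λ (u, r, σ))) = D.jA a) ∧ ContDiffOn ℝ ∞ G₁ (Set.univ ×ˢ Set.Ioo (-1 : ℝ) 1) ∧ (∀ u r σ, r ∈ Set.Ioo (-1 : ℝ) 1 → η / 2 ≤ σ → σ < η → (G₁ (u,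 r)).2 ∈ Set.Ioo (-1 : ℝ) 1 ∧ ∃ a : ↥(coresComplement h), (a : Base g) = φ ((G₁ (u, r)).1, (G₁ (u, r)).2, σ) ∧ G₀ (bX.incl (Λ (u, r, σ))) = D.jA a) ∧ (∀ u r σ, r ∈ Set.Ioo (-1 : ℝ) 1 → σ ∈ Set.Ioo (-η) η → (∃ u' r', r' ∈ Set.Ioo (-1 : ℝ) 1 ∧ ∃ a : ↥(coresComplement h), (a : Base g) = φ (u', r', σ) ∧ G₀ (bX.incl (Λ (u, r, σ))) = D.jA a) ∨ (σ = 0 ∧ ∃ θ : Metric.sphere (0 : EuclideanSpace ℝ (Fin 2)) 1, G₀ (bX.incl (Λ (u, r, σ))) = D.jB k (beltCirclePt θ))) ∧ (∀ (y : bX.carrier) (σ : ℝ), σ ∈ Set.Ioo (-η) η → ∀ a : ↥(coresComplement h), G₀ (bX.incl y) = D.jA a → (a : Base g) ∈ (fun p : ℝ × ℝ => φ (p.1, p.2, σ)) '' (Set.univ ×ˢ Set.Icc (-(1 / 2) : ℝ) (1 / 2)) → ∃ u r, r ∈ Set.Ioo (-1 : ℝ) 1 ∧ Λ (u, r, σ)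 = y) ∧ (∀ (y : bX.carrier) (θ : Metric.sphere (0 : EuclideanSpace ℝ (Fin 2)) 1), G₀ (bX.incl y) = D.jB k (beltCirclePt θ) → ∃ u r, r ∈ Set.Ioo (-1 : ℝ) 1 ∧ Λ (u, r, 0) = y))
    (Hn : ∀ (g n : ℕ) (X₀ : Type) [TopologicalSpace X₀] [T2Space X₀] [SecondCountableTopology X₀] [CompactSpace X₀] [ChartedSpace (EuclideanHalfSpace 4) X₀] [IsManifold (𝓡∂ 4) ∞ X₀] (bX : BoundaryData (𝓡∂ 4) X₀ (𝓡 3)) (Ψ : bX.carrier ≃ₘ⟮𝓡 3, 𝓡 3⟯ (bBase g).carrier) (X : Type) [TopologicalSpace X] [T2Space X] [SecondCountableTopology X] [CompactSpace X] [ChartedSpace (EuclideanHalfSpace 4) X] [IsManifold (𝓡∂ 4) ∞ X] (G₀ : X₀ ≃ₘ⟮𝓡∂ 4, 𝓡∂ 4⟯ X) (h : Fin n → HandleAttachingMap 3 2 (Base g)) (D : MultiAttachmentData h (𝓡∂ 4) X) (d : Fin n → ℂ) (k : Fin n) (s : Bool), (∀ j, ‖d j‖ = 1) → (∀ j θ,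 (h j).attachingCircle θ ∈ page g (d j)) → (∀ j, j ≠ k → d j ≠ d k) → (pageTwisting g (h k).attachingCircle (h k).attachingFraming = if s then -1 else 1) → (∀ (y : bX.carrier) (a : ↥(coresComplement h)), G₀ (bX.incl y) = D.jA a → ∃ c : ℝ, 0 < c ∧ w g ((bBase g).incl (Ψ y)).1 = (c : ℂ) * w g (a : Base g).1) → (∀ (y : bX.carrier) (j : Fin n) (b : ↥(beltPiece 3 2)), G₀ (bX.incl y) = D.jB j b → G₀ (bX.incl y) ∉ range D.jA → ∃ c : ℝ, 0 < c ∧ w g ((bBase g).incl (Ψ y)).1 = (c : ℂ) * d j) → ∀ (η₁ : ℝ) (φ : ℝ × ℝ × ℝ → Base g), 0 < η₁ → ContMDiff 𝓘(ℝ, ℝ × ℝ × ℝ) (𝓡∂ 4) ∞ φ → (∀ u r σ, φ (u + 1, r, σ) = φ (u, r, σ)) → (∀ u, φ (u, 0, 0) = (h k).attachingCircle (circlePt u)) → (∀ u r σ, σ ∈ Set.Icc (-η₁) η₁ → φ (u, r, σ) ∈ page g (d k * Complex.exp ((σ : ℂ) * Complex.I))) → (∀ u r σ, r ∈ Set.Ioo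 (-1 : ℝ) 1 → σ ∈ Set.Icc (-η₁) η₁ → φ (u, r, σ) ∈ range (h k).toFun) → (∀ σ ∈ Set.Icc (-η₁) η₁, Set.InjOn (fun p : ℝ × ℝ => φ (p.1, p.2, σ)) (Set.Ico (0 : ℝ) 1 ×ˢ Set.Ioo (-1 : ℝ) 1)) → (∀ u r σ, r ∈ Set.Ioo (-1 : ℝ) 1 → σ ∈ Set.Icc (-η₁) η₁ → 0 < inner ℝ (deriv (fun r' => (φ (u, r', σ)).1) r) (cplxJ (deriv (fun u' => (φ (u', r, σ)).1) u))) → ∀ (η : ℝ) (Λ : ℝ × ℝ × ℝ → bX.carrier) (G₁ : ℝ × ℝ → ℝ × ℝ), 0 < η → η ≤ η₁ → (ContMDiffOn 𝓘(ℝ, ℝ × ℝ × ℝ) (𝓡 3) ∞ Λ (Set.univ ×ˢ (Set.Ioo (-1 : ℝ) 1 ×ˢ Set.Ioo (-η) η)) ∧ (∀ p ∈ Set.univ ×ˢ (Set.Ioo (-1 : ℝ) 1 ×ˢ Set.Ioo (-η) η), Function.Injective (mfderiv 𝓘(ℝ, ℝ × ℝ × ℝ) (𝓡 3) Λ p)) ∧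 Set.InjOn Λ (Set.Ico (0 : ℝ) 1 ×ˢ (Set.Ioo (-1 : ℝ) 1 ×ˢ Set.Ioo (-η) η)) ∧ (∀ u r σ, Λ (u + 1, r, σ) = Λ (u, r, σ)) ∧ (∀ u r σ, r ∈ Set.Ioo (-1 : ℝ) 1 → σ ∈ Set.Ioo (-η) η → ∃ c : ℝ, 0 < c ∧ w g ((bBase g).incl (Ψ (Λ (u, r, σ)))).1 = (c : ℂ) * (d k * Complex.exp ((σ : ℂ) * Complex.I))) ∧ (∀ u r σ, r ∈ Set.Ioo (-1 : ℝ) 1 → σ ∈ Set.Ioo (-η) η → (σ ≤ -(η / 2) ∨ 1 / 2 ≤ |r|) → ∃ a : ↥(coresComplement h), (a : Base g) = φ (u, r, σ) ∧ G₀ (bX.incl (Λ (u, r, σ))) = D.jA a) ∧ ContDiffOn ℝ ∞ G₁ (Set.univ ×ˢ Set.Ioo (-1 : ℝ) 1) ∧ (∀ u r σ, r ∈ Set.Ioo (-1 : ℝ) 1 → η / 2 ≤ σ → σ < η → (G₁ (u, r)).2 ∈ Set.Ioo (-1 : ℝ) 1 ∧ ∃ a : ↥(coresComplement h), (a : Base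 g) = φ ((G₁ (u, r)).1, (G₁ (u, r)).2, σ) ∧ G₀ (bX.incl (Λ (u, r, σ))) = D.jA a) ∧ (∀ u r σ, r ∈ Set.Ioo (-1 : ℝ) 1 → σ ∈ Set.Ioo (-η) η → (∃ u' r', r' ∈ Set.Ioo (-1 : ℝ) 1 ∧ ∃ a : ↥(coresComplement h), (a : Base g) = φ (u', r', σ) ∧ G₀ (bX.incl (Λ (u, r, σ))) = D.jA a) ∨ (σ = 0 ∧ ∃ θ : Metric.sphere (0 : EuclideanSpace ℝ (Fin 2)) 1, G₀ (bX.incl (Λ (u, r, σ))) = D.jB k (beltCirclePt θ))) ∧ (∀ (y : bX.carrier) (σ : ℝ), σ ∈ Set.Ioo (-η) η → ∀ a : ↥(coresComplement h), G₀ (bX.incl y) = D.jA a → (a : Base g) ∈ (fun p : ℝ × ℝ => φ (p.1, p.2, σ)) '' (Set.univ ×ˢ Set.Icc (-(1 / 2) : ℝ) (1 / 2)) → ∃ u r, r ∈ Set.Ioo (-1 : ℝ) 1 ∧ Λ (u, r, σ) = y) ∧ (∀ (y : bX.carrier) (θ : Metric.sphere (0 : EuclideanSpace ℝ (Fin 2))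 1), G₀ (bX.incl y) = D.jB k (beltCirclePt θ) → ∃ u r, r ∈ Set.Ioo (-1 : ℝ) 1 ∧ Λ (u, r, 0) = y)) → ∀ u r r', r ∈ Set.Ico (1 / 2 : ℝ) 1 → r' ∈ Set.Ioc (-1 : ℝ) (-(1 / 2)) → (G₁ (u, r)).1 - (G₁ (u, r')).1 = if s then 1 else -1) :
    ∀ (g n : ℕ) (X₀ : Type) [TopologicalSpace X₀] [T2Space X₀] [SecondCountableTopology X₀]
      [CompactSpace X₀] [ChartedSpace (EuclideanHalfSpace 4) X₀] [IsManifold (𝓡∂ 4) ∞ X₀]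
      (bX : BoundaryData (𝓡∂ 4) X₀ (𝓡 3)) (Ψ : bX.carrier ≃ₘ⟮𝓡 3, 𝓡 3⟯ (bBase g).carrier)
      (X : Type) [TopologicalSpace X] [T2Space X] [SecondCountableTopology X] [CompactSpace X]
      [ChartedSpace (EuclideanHalfSpace 4) X] [IsManifold (𝓡∂ 4) ∞ X]
      (G₀ : X₀ ≃ₘ⟮𝓡∂ 4, 𝓡∂ 4⟯ X)
      (h : Fin n → HandleAttachingMap 3 2 (Base g)) (D : MultiAttachmentData h (𝓡∂ 4) X)
      (d : Fin n → ℂ) (k : Fin n) (s : Bool),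
      (∀ j, ‖d j‖ = 1) →
      (∀ j θ, (h j).attachingCircle θ ∈ page g (d j)) →
      (∀ j, j ≠ k → d j ≠ d k) →
      (pageTwisting g (h k).attachingCircle (h k).attachingFraming = if s then -1 else 1) →
      (∀ (y : bX.carrier) (a : ↥(coresComplement h)), G₀ (bX.incl y) = D.jA a →
        ∃ c : ℝ, 0 < c ∧ w g ((bBase g).incl (Ψ y)).1 = (c : ℂ) * w g (a : Base g).1) →
      (∀ (y : bX.carrier) (j : Fin n) (b : ↥(beltPiece 3 2)), G₀ (bX.incl y) = D.jB j b →
        G₀ (bX.incl y) ∉ range D.jA →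
        ∃ c : ℝ, 0 < c ∧ w g ((bBase g).incl (Ψ y)).1 = (c : ℂ) * d j) →
      -- a FIBRED FAMILY OF ANNULUS CHARTS `φ (·,·,σ)` of the pages `d k · e^{iσ}`, `|σ| ≤ η₁`, around `γ_k`
      -- (the consumer's own: e.g. the `R`-transports of ONE chart of the belt page, `R` its sector rotation)
      ∀ (η₁ : ℝ) (φ : ℝ × ℝ × ℝ → Base g), 0 < η₁ →
      ContMDiff 𝓘(ℝ, ℝ × ℝ × ℝ) (𝓡∂ 4) ∞ φ →
      (∀ u r σ, φ (u + 1, r, σ) = φ (u, r, σ)) →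
      (∀ u, φ (u, 0, 0) = (h k).attachingCircle (circlePt u)) →
      (∀ u r σ, σ ∈ Set.Icc (-η₁) η₁ →
        φ (u, r, σ) ∈ page g (d k * Complex.exp ((σ : ℂ) * Complex.I))) →
      (∀ u r σ, r ∈ Set.Ioo (-1 : ℝ) 1 → σ ∈ Set.Icc (-η₁) η₁ → φ (u, r, σ) ∈ range (h k).toFun) →
      (∀ σ ∈ Set.Icc (-η₁) η₁,
        Set.InjOn (fun p : ℝ × ℝ => φ (p.1, p.2, σ)) (Set.Ico (0 : ℝ) 1 ×ˢ Set.Ioo (-1 : ℝ) 1)) →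
      (∀ u r σ, r ∈ Set.Ioo (-1 : ℝ) 1 → σ ∈ Set.Icc (-η₁) η₁ →
        0 < inner ℝ (deriv (fun r' => (φ (u, r', σ)).1) r)
          (cplxJ (deriv (fun u' => (φ (u', r, σ)).1) u))) →
      ∃ (η : ℝ) (G : ℝ × ℝ → ℝ × ℝ) (Λ : ℝ × ℝ × ℝ → bX.carrier),
        0 < η ∧ η ≤ η₁ ∧
        -- the return map `G` (lift of an annulus map; displacement `n₀ = ±1` between the two sides)
        ContDiff ℝ ∞ G ∧ (∀ u r, G (u + 1, r) = G (u, r) + (1, 0)) ∧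
        (∀ u r, r ≤ -(1 / 2 : ℝ) → G (u, r) = (u, r)) ∧
        (∀ u r, (1 / 2 : ℝ) ≤ r → G (u, r) = (u + (if s then 1 else -1), r)) ∧
        (∀ u r, r ∈ Set.Ioo (-1 : ℝ) 1 → (G (u, r)).2 ∈ Set.Ioo (-1 : ℝ) 1) ∧
        -- the two-sided fibred belt chart `Λ`
        ContMDiffOn 𝓘(ℝ, ℝ × ℝ × ℝ) (𝓡 3) ∞ Λ
          (Set.univ ×ˢ (Set.Ioo (-1 : ℝ) 1 ×ˢ Set.Ioo (-η) η)) ∧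
        (∀ p ∈ Set.univ ×ˢ (Set.Ioo (-1 : ℝ) 1 ×ˢ Set.Ioo (-η) η),
          Function.Injective (mfderiv 𝓘(ℝ, ℝ × ℝ × ℝ) (𝓡 3) Λ p)) ∧
        Set.InjOn Λ (Set.Ico (0 : ℝ) 1 ×ˢ (Set.Ioo (-1 : ℝ) 1 ×ˢ Set.Ioo (-η) η)) ∧
        (∀ u r σ, Λ (u + 1, r, σ) = Λ (u, r, σ)) ∧
        -- FIBRED
        (∀ u r σ, r ∈ Set.Ioo (-1 : ℝ) 1 → σ ∈ Set.Ioo (-η) η → ∃ c : ℝ, 0 < c ∧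
          w g ((bBase g).incl (Ψ (Λ (u, r, σ)))).1 =
            (c : ℂ) * (d k * Complex.exp ((σ : ℂ) * Complex.I))) ∧
        -- BELOW and on the SIDES: plain seam, same chart coordinates
        (∀ u r σ, r ∈ Set.Ioo (-1 : ℝ) 1 → σ ∈ Set.Ioo (-η) η → (σ ≤ -(η / 2) ∨ 1 / 2 ≤ |r|) →
          ∃ a : ↥(coresComplement h), (a : Base g) = φ (u, r, σ) ∧
            G₀ (bX.incl (Λ (u, r, σ))) = D.jA a) ∧
        -- ABOVE: plain seam, chart coordinates TWISTED by `G` (right-handed iff `s`)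
        (∀ u r σ, r ∈ Set.Ioo (-1 : ℝ) 1 → η / 2 ≤ σ → σ < η →
          ∃ a : ↥(coresComplement h),
            (a : Base g) = φ ((G (u, r)).1, (G (u, r)).2, σ) ∧
            G₀ (bX.incl (Λ (u, r, σ))) = D.jA a) ∧
        -- IMAGE: seam points over the chart, or (level `0`) deep belt points of handle `k`
        (∀ u r σ, r ∈ Set.Ioo (-1 : ℝ) 1 → σ ∈ Set.Ioo (-η) η →
          (∃ u' r', r' ∈ Set.Ioo (-1 : ℝ) 1 ∧ ∃ a : ↥(coresComplement h),
              (a : Base g) = φ (u', r', σ) ∧ G₀ (bX.incl (Λ (u, r, σ))) = D.jA a) ∨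
          (σ = 0 ∧ (∀ a : ↥(coresComplement h), G₀ (bX.incl (Λ (u, r, σ))) ≠ D.jA a) ∧
            ∃ b : ↥(beltPiece 3 2), G₀ (bX.incl (Λ (u, r, σ))) = D.jB k b)) ∧
        -- COVER: the dichotomy over the arc of angles `(θ_k − η, θ_k + η)`
        (∀ (y : bX.carrier) (σ : ℝ), σ ∈ Set.Ioo (-η) η →
          (∃ c : ℝ, 0 < c ∧ w g ((bBase g).incl (Ψ y)).1 =
            (c : ℂ) * (d k * Complex.exp ((σ : ℂ) * Complex.I))) →
          (∃ u r, r ∈ Set.Ioo (-1 : ℝ) 1 ∧ Λ (u, r, σ) = y) ∨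
          (∃ a : ↥(coresComplement h), G₀ (bX.incl y) = D.jA a ∧
            (a : Base g) ∉ (fun p : ℝ × ℝ => φ (p.1, p.2, σ)) ''
              (Set.univ ×ˢ Set.Icc (-(1 / 2) : ℝ) (1 / 2)))) :=
  N1Mono_of_flowChartInteger (by
    intro g n X₀ _ _ _ _ _ _ bX Ψ X _ _ _ _ _ _ G₀ h D d k s hd hpg hdir htw hseam hbelt η₁ φ hη₁ hφ hφper
      hφcore hφpage hφrange hφinj hφor η₂ hη₂
    obtain ⟨η, Λ, G₁, hη, h1, h2, hbody⟩ := HΛ g n X₀ bX Ψ X G₀ h D d k s hd hpg hdir htw hseam hbelt η₁ φ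
      hη₁ hφ hφper hφcore hφpage hφrange hφinj hφor η₂ hη₂
    exact ⟨η, Λ, G₁, hη, h1, h2, Hn g n X₀ bX Ψ X G₀ h D d k s hd hpg hdir htw hseam hbelt η₁ φ hη₁ hφ
      hφper hφcore hφpage hφrange hφinj hφor η Λ G₁ hη h1 hbody, hbody⟩)

end Summit.SmoothPoincare4.SmoothPoincare4.Theorems.AcyclicBisectionExists.ModpBraidOrbits

end
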